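import Literature.AlgebraicGeometry.Modules.SerreTwistTrivial
import Literature.AlgebraicGeometry.Modules.SerreTheoremA
import Literature.AlgebraicGeometry.Modules.RankOneModuleDivisorDictionary
import Literature.AlgebraicGeometry.Modules.LineBundleOfCocycleClass
import Literature.AlgebraicGeometry.Motives.GeneratingSectionsOfHomAppLE
import Literature.AlgebraicGeometry.Motives.CartierDivisorCocycle
import Literature.AlgebraicGeometry.Modules.DetClassDual
import Literature.AlgebraicGeometry.Modules.PullbackPushforwardCounitEpiProjective
import HarnessLib

/-!
# `𝒪_Z(-m) = 𝒪_Z(-m·H_ι)`: the determinant class of the Serre twist `serreTwist ι m` is the inverse of the class of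
# `m` times the hyperplane divisor — the twist dictionary between the ProjCech and the Cartier-divisor dialects

Layer `Literature/AlgebraicGeometry/Modules`; theorems only (no `def`, no instance, no notation, no named fact, no `sorry`).

The tree holds TWO descriptions of the twisting sheaves of a closed subscheme `ι : Z ↪ 𝐏ʳ_A = ProjCech.PP A r`:
* the ProjCech / Serre dialect (`Modules/SerreTwist*`): `serreTwist ι m = 𝒪_Z(-m)` as the subsheaf of `𝒪_Z^{W_m}` cut out by the
  chart relations, free of rank one on `Z_j = ι⁻¹D₊(x_j)` on the generator `v_j` (★ `SerreTwist.gen`) with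
  `v_j = (x_{j'}/x_j)^m v_{j'}` (★ `gen_restrict_eq_smul_gen`), the chart functions `x_i/x_j = chartFun ι i j ∈ Γ(Z, Z_j)` being
  defined through the tree's Laurent evaluation `ProjCech.evalRing` ([Hartshorne1977] II Prop. 5.12);
* the Cartier-divisor dialect (`Motives/CartierDivisor`, `Motives/ProjectiveOfGeneratingSections`, `Motives/AbelianVarietyDegree`):
  for `Z` INTEGRAL, the hyperplane divisor `H_ι = div(ι^*x_{a₀}) = (GeneratingSections.ofHom ι).divisor a₀ _` with local equations
  the ratios `homRatio ι a a₀ = ι^*(x_{a₀}/x_a)` ([Hartshorne1977] II Thm. 7.1 (a)), its multiples `m • H_ι`, and their classes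
  `CartierDivisor.cechClass` in `CechPic Z = Ȟ¹(Z, 𝒪_Z^×)` ([GortzWedhorn2020] Prop. 11.21).

This file PROVES that they agree — «`𝒪_Z(-m) ≅ 𝒪_Z(-m H_ι)`», [Hartshorne1977] II Prop. 5.12 (b)/(c) with II Prop. 6.18 / 7.1: the
determinant class (★ `Modules/DeterminantCocycle.detClass`) of the rank-one module `serreTwist ι m` is `[𝒪_Z(m • H_ι)]⁻¹`:

* §1 the bridge between the dialects: Mathlib's universal ratio section `Proj.awayToSection (x_b/x_a)` over `D₊(x_a)` in the
  Motives spelling (`Segre.frac k a b` over `Proj.basicOpen (X a)`) and in the ProjCech spelling (`isLocalizationElem` over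
  `Dplus {a} = D₊(X_{{a}})`, `X_{{a}} = ∏_{i ∈ {a}} x_i`) agree on every common open (`map_awayToSection_frac_eq`, pointwise values in
  the homogeneous localisations, Mathlib `Proj.awayToSection_apply`); hence `homRatio ι a b` (★ `GeneratingSections.homRatio_eq_appLE`)
  and `chartFun ι b a` have the same restrictions (`chartFun_eq_appLE`, `map_homRatio_eq_map_chartFun`);
* §2 the chart frames `𝒪^{PUnit} ≅ 𝒪|_{Z_j} ≅ 𝒪_Z(-m)|_{Z_j}` (★ `freePUnitIso`, ★ `SerreTwist.overIsoUnit`): basis section `v_j`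
  (`basisSection_chartFrame`) and transition function `(x_j/x_{j'})^m` (`transitionDet_chartFrame`, template ★
  `lineBundleFrameSystem_cocycle_g`);
* §3 **`detClass_serreTwist_eq : detClass (isFiniteLocallyFree_serreTwist ι m) = ((m • H_ι).cechClass)⁻¹`** for `Z` integral and
  `ξ ∈ ι⁻¹D₊(x_{a₀})` — frame system on the charts `Z_{j(x)}` with `j(ξ) = a₀`, whose INVERSE cocycle has local equations
  `f_x = (x_{a₀}/x_{j(x)})^m` (★ `UnitCocycle.toCartierDivisor`, ★ `UnitCocycle.cechClass_toCartierDivisor`) presenting the SAME divisor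
  as `m • H_ι` (`f_x / (x_{a₀}/x_a)^m = (x_a/x_{j(x)})^m`, a unit on `Z_{j(x)} ∩ Z_a`: ★ `chartFun_cocycle`, ★ `Zop_singleton_inf_eq_basicOpen`),
  ★ `SameDivisor.cechClass_eq`; corollaries `detClass_dual_serreTwist_eq` («`𝒪_Z(m) := 𝒪_Z(-m)^∨` has class `[m • H_ι]`») and
  **`nonempty_dual_serreTwist_iso_lineBundle : Nonempty (dual (serreTwist ι m) ≅ Modules.lineBundle (m • H_ι).toUnitCocycle)`**
  (★ `nonempty_iso_iff_detClass_eq`, ★ `hasRank_serreTwist`, ★ `hasRank_lineBundle`, ★ `detClass_lineBundle`).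

* §4 (edition 2) naturality WITHOUT integrality: **`detClass_serreTwist_eq_pow`** (`[𝒪_Z(-m)] = [𝒪_Z(-1)]^m`),
  **`detClass_serreTwist_mul`** (`[𝒪_Z(-m·t)] = [𝒪_Z(-m)]^t`) and **`detClass_serreTwist_comp`** (`[𝒪_Y(-m)] = k^*[𝒪_Z(-m)]` along
  `k ≫ φ`, [Hartshorne1977] II Prop. 5.12 (c) / II Ex. 6.8) — the chart frame systems share their charts and the cocycle of `k ≫ φ`
  is the pulled-back cocycle (★ `UnitCocycle.pullback`, ★ `CechPic.pullback_mk`); consumer: the cell's F-9 (M2d) `hF9` assembly.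

Consumer: V2 of the cell's F-2 (b) field-case line — Serre's vanishing theorem for the twists `G(n) = twistMod ι G n` (★
`Modules/SerreVanishingTwist`, ProjCech dialect) transported to the line bundles `𝒪_X(m • Θ)` of the multiples of an ample Cartier
divisor (`Modules/SerreVanishingAmpleMultiples`, via ★ `IsAmple.exists_pos_smul_linEquiv_hyperplaneDivisor`: `q • Θ ∼ H_ι`).
Cell hodgecm-mathlib; count-neutral Literature capital.  HC_CM is proved only modulo the printed citations until rung 0 closes; this
file discharges none of them.

## References
* [Hartshorne1977] R. Hartshorne, *Algebraic Geometry*, GTM 52 (1977): II Prop. 2.5 (b) (sections of `𝒪` on `D₊(f)`), II Prop. 5.12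
  (`𝒪(n)`, p. 117), II Prop. 6.13 and Cor. 6.14 (`CaCl ≅ Pic` on integral schemes), II Thm. 7.1 (a) (p. 150), II Ex. 5.16 (d).
* [GortzWedhorn2020] U. Görtz, T. Wedhorn, *Algebraic Geometry I*, 2nd ed. (2020): (11.9), Prop. 11.21 (p. 302); (13.6)–(13.8)
  (`𝒪_{ℙ}(n)` and hyperplanes).
-/

noncomputable section

set_option backward.isDefEq.respectTransparency false

open CategoryTheory AlgebraicGeometry TopologicalSpace Opposite
open Literature.Algebra.Homology Literature.Algebra.Homology.LaurentCech
open Literature.AlgebraicGeometry.Morphisms Literature.AlgebraicGeometry.Morphisms.ProjCech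
open Literature.AlgebraicGeometry.Motives

universe u

-- Mathlib keeps `MvPolynomial.gradedAlgebra` a `def`; made an instance locally as in the tree's `Proj k[x₀,…,x_n]` files
-- (e.g. ★ `Modules/SerreVanishingTwist`, ★ `Motives/GeneratingSectionsOfHomAppLE`).
attribute [local instance] MvPolynomial.gradedAlgebra

namespace Literature.AlgebraicGeometry.Modules

namespace SerreTwist

/-! ### §1 The two dialects for `x_b / x_a` agree -/

section Bridge

variable {k : Type u} [CommRing k] {n : ℕ}

/-- **The universal ratio section `x_b/x_a` in the two spellings agrees**: Mathlib's `Proj.awayToSection` of `Segre.frac k a b ∈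
(k[x]_{(x_a)})₀` (Motives) and of `isLocalizationElem` in `(k[x]_{(X_{{a}})})₀`, `X_{{a}} = ∏_{i∈{a}} x_i` (ProjCech), have the same
restriction to every open below `D₊(x_a)` and `D₊(X_{{a}})` — their values in the homogeneous localisations at each point are both
`x_b/x_a` (Mathlib `Proj.awayToSection_apply`). [cite: Hartshorne1977, II Prop. 2.5 (b)] -/
theorem map_awayToSection_frac_eq (a b : Fin (n + 1)) {W : (PP k n).Opens}
    (h₁ : W ≤ Proj.basicOpen (grading k n) (MvPolynomial.X a)) (h₂ : W ≤ Dplus k n {a}) :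
    (PP k n).presheaf.map (homOfLE h₁).op
        (Proj.awayToSection (grading k n) (MvPolynomial.X a) (Segre.frac k a b)) =
      (PP k n).presheaf.map (homOfLE h₂).op
        (Proj.awayToSection (grading k n) (Xs k {a})
          (HomogeneousLocalization.Away.isLocalizationElem (Xs_mem (A := k) {a})
            (Xs_mem (({b} : Finset (Fin (n + 1))).erase a)))) := by
  apply Proj.ext
  funext p
  apply HomogeneousLocalization.val_injective
  change (((ProjectiveSpectrum.Proj.structureSheaf (grading k n)).1.map (homOfLE h₁).op _).1 p).val =
    (((ProjectiveSpectrum.Proj.structureSheaf (grading k n)).1.map (homOfLE h₂).op _).1 p).val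
  rw [Proj.res_apply, Proj.res_apply]
  erw [ProjectiveSpectrum.Proj.awayToSection_apply, ProjectiveSpectrum.Proj.awayToSection_apply]
  rw [Segre.val_frac]
  simp only [HomogeneousLocalization.Away.isLocalizationElem, HomogeneousLocalization.Away.val_mk]
  rw [Localization.mk_eq_mk', Localization.mk_eq_mk', IsLocalization.map_mk', IsLocalization.map_mk']
  apply IsLocalization.mk'_eq_of_eq
  simp only [RingHom.id_apply, Finset.card_singleton, pow_one]
  by_cases hab : b = a
  · subst hab
    simp [Xs, Finset.erase_singleton]
  · rw [Finset.erase_eq_of_notMem (by rw [Finset.mem_singleton]; exact fun h => hab h.symm)]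
    simp [Xs, Finset.prod_singleton]

/-- The chart function `chartFun ι b a = x_b/x_a ∈ Γ(Z, Z_a)` of ★ `Modules/SerreTwist` is `ι^*` of the universal ratio section over
`D₊(X_{{a}})` (unfolding ★ `evalRing_apply`, ★ `awayEquiv_symm_tElB`). [cite: Hartshorne1977, II Prop. 2.5 (b)] -/
theorem chartFun_eq_appLE {Z : Scheme.{u}} (ι : Z ⟶ PP k n) (a b : Fin (n + 1)) :
    chartFun ι b a = ι.appLE (Dplus k n {a}) (Zop ι {a}) le_rfl
      (Proj.awayToSection (grading k n) (Xs k {a})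
        (HomogeneousLocalization.Away.isLocalizationElem (Xs_mem (A := k) {a})
          (Xs_mem (({b} : Finset (Fin (n + 1))).erase a)))) := by
  change evalRing ι {a} (tElB k {b} a) = _
  rw [evalRing_apply, awayEquiv_symm_tElB, Scheme.Hom.app_eq_appLE]

/-- **The two dialects agree on `Z`**: the ratio `homRatio ι a b = ι^*(x_b/x_a) ∈ Γ(Z, ι⁻¹D₊(x_a))` of `GeneratingSections.ofHom ι`
(★ `homRatio_eq_appLE`) and the chart function `chartFun ι b a ∈ Γ(Z, Z_a)` of the Serre twists have the same restriction to every open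
below both charts. [cite: Hartshorne1977, II Thm. 7.1 (a)] -/
theorem map_homRatio_eq_map_chartFun {Z : Scheme.{u}} (ι : Z ⟶ PP k n) (a b : Fin (n + 1)) {V : Z.Opens}
    (h₁ : V ≤ GeneratingSections.preU ι a) (h₂ : V ≤ Zop ι {a}) :
    Z.presheaf.map (homOfLE h₁).op (GeneratingSections.homRatio ι a b) =
      Z.presheaf.map (homOfLE h₂).op (chartFun ι b a) := by
  rw [GeneratingSections.homRatio_eq_appLE, chartFun_eq_appLE]
  set W : (PP k n).Opens := Proj.basicOpen (grading k n) (MvPolynomial.X a) ⊓ Dplus k n {a} with hW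
  have hV : V ≤ ι ⁻¹ᵁ W := le_inf h₁ h₂
  -- both sides are `ι.appLE W V hV` of the restricted universal sections
  have e₁ : ∀ (U : (PP k n).Opens) (V₀ : Z.Opens) (hV₀ : V₀ ≤ ι ⁻¹ᵁ U) (hVV₀ : V ≤ V₀) (hWU : W ≤ U)
      (s : Γ(PP k n, U)),
      Z.presheaf.map (homOfLE hVV₀).op (ι.appLE U V₀ hV₀ s) =
        ι.appLE W V hV ((PP k n).presheaf.map (homOfLE hWU).op s) := by
    intro U V₀ hV₀ hVV₀ hWU s
    rw [← CommRingCat.comp_apply (ι.appLE U V₀ hV₀) (Z.presheaf.map (homOfLE hVV₀).op) s,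
      Scheme.Hom.appLE_map,
      ← CommRingCat.comp_apply ((PP k n).presheaf.map (homOfLE hWU).op) (ι.appLE W V hV) s,
      Scheme.Hom.map_appLE]
  rw [e₁ _ _ _ h₁ inf_le_left, e₁ _ _ _ h₂ inf_le_right, map_awayToSection_frac_eq a b inf_le_left inf_le_right]

end Bridge

/-! ### §2 The chart frames of `𝒪_Z(-m)` and their transition functions -/

section Frames

variable {A : Type u} [CommRing A] {r : ℕ} {Z : Scheme.{u}} (ι : Z ⟶ PP A r) (m : ℕ)

/-- The inverse chart trivialisation `𝒪|_{Z_j} ⟶ 𝒪_Z(-m)|_{Z_j}` (★ `overIsoUnit`) on sections over `W ⊆ Z_j` is `c ↦ c · v_j|_W`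
(definitional: ★ `chartLinearEquiv_symm_apply`). [cite: Hartshorne1977, II Prop. 5.12] -/
theorem appLE_overIsoUnit_inv (j : Fin (r + 1)) {W : Z.Opens} (k : W ⟶ Zop ι {j}) (c : Γ(Z, W)) :
    appLE (E := unitModule Z) (overIsoUnit ι m j).inv k c =
      c • (serreTwist ι m).presheaf.map (homOfLE k.le).op (gen ι m j) := by
  rfl

/-- The basis section of the chart frame `𝒪^{PUnit} ≅ 𝒪|_{Z_j} ≅ 𝒪_Z(-m)|_{Z_j}` (★ `freePUnitIso`, ★ `overIsoUnit`) is the local generator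
`v_j = gen ι m j`. [cite: Hartshorne1977, II Prop. 5.12] -/
theorem basisSection_chartFrame (j : Fin (r + 1)) :
    basisSection (E := serreTwist ι m) (freePUnitIso (Zop ι {j}) ≪≫ (overIsoUnit ι m j).symm) PUnit.unit =
      gen ι m j := by
  rw [basisSection, Iso.trans_hom, SheafOfModules.freeHomEquiv_comp_apply, overSectionsEquiv_sectionsMap']
  change appLE (E := unitModule Z) (overIsoUnit ι m j).inv (𝟙 _)
    (basisSection (E := unitModule Z) (freePUnitIso (Zop ι {j})) PUnit.unit) = _
  rw [← one_eq_basisSection_freePUnitIso, appLE_overIsoUnit_inv, one_smul]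
  exact map_id_apply _ _

/-- **The transition function of `𝒪_Z(-m)` between the chart frames `j`, `j'` over `V ⊆ Z_j ∩ Z_{j'}` is `(x_j/x_{j'})^m`**
(`v_{j'} = (x_j/x_{j'})^m v_j`, ★ `gen_restrict_eq_smul_gen`; rank one: ★ `transitionDet_eq_of_subsingleton`).
[cite: Hartshorne1977, II Prop. 5.12] [cite: Hartshorne1977, II Ex. 5.16 (d)] -/
theorem transitionDet_chartFrame (j j' : Fin (r + 1)) {V : Z.Opens} (hj : V ≤ Zop ι {j})
    (hj' : V ≤ Zop ι {j'}) :
    transitionDet (freePUnitIso (Zop ι {j}) ≪≫ (overIsoUnit ι m j).symm)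
        (freePUnitIso (Zop ι {j'}) ≪≫ (overIsoUnit ι m j').symm)
        (_root_.Equiv.ofUnique PUnit (Fin 1)) (_root_.Equiv.ofUnique PUnit (Fin 1)) (homOfLE hj) (homOfLE hj') =
      Z.presheaf.map (homOfLE hj').op (chartFun ι j j') ^ m := by
  classical
  rw [transitionDet_eq_of_subsingleton _ _ _ _ _ _ PUnit.unit PUnit.unit, transition_apply,
    basisSection_chartFrame, gen_restrict_eq_smul_gen ι j' j hj' hj, coord_smul,
    ← basisSection_chartFrame ι m j, coord_map_basisSection, if_pos rfl, mul_one]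

end Frames

/-! ### §3 The determinant class of `𝒪_Z(-m)` is `[𝒪_Z(m • H_ι)]⁻¹` -/

section DetClass

variable {A : Type u} [CommRing A] {r : ℕ} {Z : Scheme.{u}} (ι : Z ⟶ PP A r)

/-- The ProjCech chart `Z_{{a}} = ι⁻¹D₊(X_{{a}})` IS the chart `ι⁻¹D₊(x_a)` of `GeneratingSections.ofHom ι` (`X_{{a}} = x_a`,
`Finset.prod_singleton`). [cite: Hartshorne1977, II Prop. 2.5 (b)] -/
theorem Zop_singleton_eq_preU (a : Fin (r + 1)) : Zop ι {a} = GeneratingSections.preU ι a := by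
  change ι ⁻¹ᵁ Proj.basicOpen (grading A r) (Xs A {a}) = ι ⁻¹ᵁ Proj.basicOpen (grading A r) (MvPolynomial.X a)
  rw [Xs, Finset.prod_singleton]

variable [IsIntegral Z]

open RatFn in
/-- **`[𝒪_Z(-m)] = [𝒪_Z(m • H_ι)]⁻¹` in `Ȟ¹(Z, 𝒪_Z^×)`** for a morphism `ι : Z ⟶ 𝐏ʳ_A` from an INTEGRAL scheme whose generic point lies
in `ι⁻¹D₊(x_{a₀})`, `H_ι = div(ι^*x_{a₀})` the hyperplane divisor of `GeneratingSections.ofHom ι`: the determinant class of the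
rank-one module `serreTwist ι m` is the inverse of the class of `m • H_ι`.  Frame system on the charts `Z_{j(x)}` (`j(ξ) = a₀`) with
transition functions `(x_{j(x)}/x_{j(y)})^m` (`transitionDet_chartFrame`); its inverse cocycle has local equations
`f_x = g_{ξx} = (x_{a₀}/x_{j(x)})^m` (★ `UnitCocycle.toCartierDivisor`, class ★ `cechClass_toCartierDivisor`), which present the SAME
divisor as `m • H_ι` — `f_x / (x_{a₀}/x_a)^m = (x_a/x_{j(x)})^m` is a unit on `Z_{j(x)} ∩ Z_a` (§1 bridge, ★ `chartFun_cocycle`,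
★ `Zop_singleton_inf_eq_basicOpen`) — so the classes agree (★ `SameDivisor.cechClass_eq`).
[cite: Hartshorne1977, II Prop. 5.12] [cite: GortzWedhorn2020, Prop. 11.21 (p. 302)] -/
theorem detClass_serreTwist_eq (m : ℕ) (a₀ : Fin (r + 1))
    (ha₀ : genericPoint Z ∈ (GeneratingSections.ofHom ι).U a₀) :
    detClass (isFiniteLocallyFree_serreTwist ι m) =
      ((m • (GeneratingSections.ofHom ι).divisor a₀ ha₀).cechClass)⁻¹ := by
  classical
  -- `ξ ∈ Z_{a₀}`
  have hξ : genericPoint Z ∈ Zop ι {a₀} := by rw [Zop_singleton_eq_preU]; exact ha₀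
  -- a chart choice `x ↦ j x` with `j ξ = a₀`
  have hcov : ∀ x : Z, ∃ i : Fin (r + 1), x ∈ Zop ι {i} := fun x => by
    have hx : x ∈ (⊤ : Z.Opens) := trivial
    rw [← iSup_cover_eq_top ι] at hx
    exact Opens.mem_iSup.mp hx
  let j : Z → Fin (r + 1) := fun x => if x ∈ Zop ι {a₀} then a₀ else (hcov x).choose
  have hj : ∀ x, x ∈ Zop ι {j x} := fun x => by
    by_cases hx : x ∈ Zop ι {a₀}
    · simp only [j, if_pos hx]; exact hx
    · simp only [j, if_neg hx]; exact (hcov x).choose_spec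
  have hjξ : j (genericPoint Z) = a₀ := if_pos hξ
  -- the frame system on the charts `Z_{j x}`
  let F : FrameSystem (serreTwist ι m) :=
    { U := fun x => Zop ι {j x}
      mem := hj
      I := fun _ => PUnit.{u + 1}
      rank := fun _ => 1
      enum := fun _ => _root_.Equiv.ofUnique PUnit (Fin 1)
      frame := fun x => freePUnitIso (Zop ι {j x}) ≪≫ (overIsoUnit ι m (j x)).symm }
  have hFg : ∀ (x y : Z) (V : Z.Opens) (hx : V ≤ Zop ι {j x}) (hy : V ≤ Zop ι {j y}),
      F.cocycle.g x y V hx hy = Z.presheaf.map (homOfLE hy).op (chartFun ι (j x) (j y)) ^ m :=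
    fun x y V hx hy => transitionDet_chartFrame ι m (j x) (j y) hx hy
  rw [detClass_eq_mk _ F, ← inv_inv (CechPic.mk F.cocycle), ← CechPic.mk_inv,
    ← UnitCocycle.cechClass_toCartierDivisor]
  congr 1
  apply CartierDivisor.SameDivisor.cechClass_eq
  intro (x : Z) i (z : Z) hzx hzi
  -- the points and opens in play
  have hzx' : z ∈ Zop ι {j x} := hzx
  have hzi' : z ∈ GeneratingSections.preU ι i.down := hzi
  have hzi'' : z ∈ Zop ι {i.down.1} := by rw [Zop_singleton_eq_preU]; exact hzi'
  -- (1) the local equation of the inverse frame cocycle at `x`: `(x_{a₀} / x_{j x})^m`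
  have h1 : F.cocycle.inv.toCartierDivisor.f x =
      ofSection (genericPoint_mem_of_mem (hj x)) (chartFun ι a₀ (j x)) ^ m := by
    change F.cocycle.inv.ratFn x = _
    have hV₁ : Zop ι {j x} ⊓ Zop ι {a₀} ≤ Zop ι {j x} := inf_le_left
    have hV₂ : Zop ι {j x} ⊓ Zop ι {a₀} ≤ Zop ι {j (genericPoint Z)} := by rw [hjξ]; exact inf_le_right
    have hVξ : genericPoint Z ∈ Zop ι {j x} ⊓ Zop ι {a₀} := ⟨genericPoint_mem_of_mem (hj x), hξ⟩
    rw [UnitCocycle.ratFn, ← F.cocycle.inv.ofSection_g x (genericPoint Z) hV₁ hV₂ hVξ]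
    change ofSection hVξ (F.cocycle.g (genericPoint Z) x _ hV₂ hV₁) = _
    rw [hFg]
    change (Z.presheaf.germ _ (genericPoint Z) hVξ) (_ ^ m) = _
    rw [map_pow]
    change ofSection hVξ _ ^ m = _
    rw [ofSection_map]
    congr 2
    rw [hjξ]
  -- (2) the local equation of `m • H_ι` at the chart `i`: `(x_{a₀} / x_i)^m`, in the ProjCech dialect
  have h2 : (m • (GeneratingSections.ofHom ι).divisor a₀ ha₀).f i =
      ofSection (genericPoint_mem_of_mem hzi'') (chartFun ι a₀ i.down.1) ^ m := by
    change (GeneratingSections.ofHom ι).ratioFn i.down a₀ i.down.2 ^ m = _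
    congr 1
    change ofSection i.down.2 (GeneratingSections.homRatio ι i.down.1 a₀) = _
    have hW : genericPoint Z ∈ GeneratingSections.preU ι i.down.1 ⊓ Zop ι {i.down.1} :=
      ⟨i.down.2, genericPoint_mem_of_mem hzi''⟩
    rw [← ofSection_map (homOfLE inf_le_left) hW, ← ofSection_map (homOfLE inf_le_right) hW,
      map_homRatio_eq_map_chartFun]
  rw [h1, h2, ← div_pow]
  refine IsUnitAt.pow ?_ m
  -- (3) the quotient is `x_i / x_{j x}`, a unit on `Z_{j x} ∩ Z_i ∋ z`
  have hW' : genericPoint Z ∈ Zop ι {j x} ⊓ Zop ι {i.down.1} :=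
    ⟨genericPoint_mem_of_mem (hj x), genericPoint_mem_of_mem hzi''⟩
  have hne : ofSection (genericPoint_mem_of_mem hzi'') (chartFun ι a₀ i.down.1) ≠ 0 := by
    refine IsUnitAt.ne_zero (x := genericPoint Z) ?_
    rw [isUnitAt_ofSection_iff (genericPoint_mem_of_mem hzi''), ← Zop_singleton_inf_eq_basicOpen]
    exact ⟨genericPoint_mem_of_mem hzi'', hξ⟩
  have hquot : ofSection (genericPoint_mem_of_mem (hj x)) (chartFun ι a₀ (j x)) /
        ofSection (genericPoint_mem_of_mem hzi'') (chartFun ι a₀ i.down.1) =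
      ofSection (genericPoint_mem_of_mem (hj x)) (chartFun ι i.down.1 (j x)) := by
    rw [div_eq_iff hne, ← ofSection_map (homOfLE (inf_le_left : Zop ι {j x} ⊓ Zop ι {i.down.1} ≤ _)) hW'
        (chartFun ι a₀ (j x)), chartFun_cocycle ι a₀ (j x) i.down.1 inf_le_left inf_le_right]
    change (Z.presheaf.germ _ (genericPoint Z) hW') (_ * _) = _
    rw [map_mul]
    change ofSection hW' _ * ofSection hW' _ = _
    rw [ofSection_map, ofSection_map, mul_comm]
  rw [hquot, isUnitAt_ofSection_iff hzx', ← Zop_singleton_inf_eq_basicOpen]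
  exact ⟨hzx', hzi''⟩


/-- **`[𝒪_Z(m)] = [𝒪_Z(m • H_ι)]`**: the dual `𝒪_Z(m) := 𝒪_Z(-m)^∨` of the Serre twist has the class of `m • H_ι` (★ `detClass_dual`).
[cite: Hartshorne1977, II Prop. 5.12] [cite: GortzWedhorn2020, Prop. 11.21 (p. 302)] -/
theorem detClass_dual_serreTwist_eq (m : ℕ) (a₀ : Fin (r + 1))
    (ha₀ : genericPoint Z ∈ (GeneratingSections.ofHom ι).U a₀) :
    detClass (isFiniteLocallyFree_dual (isFiniteLocallyFree_serreTwist ι m)) =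
      (m • (GeneratingSections.ofHom ι).divisor a₀ ha₀).cechClass := by
  rw [detClass_dual (isFiniteLocallyFree_serreTwist ι m), detClass_serreTwist_eq ι m a₀ ha₀, inv_inv]

/-- **`𝒪_Z(m) ≅ 𝒪_Z(m • H_ι)` as `𝒪_Z`-modules**: the dual of the Serre twist `serreTwist ι m` is isomorphic to the line bundle of the
Cartier divisor `m • H_ι` (★ `Modules.lineBundle`, ★ `CartierDivisor.toUnitCocycle`) — both have rank one (★ `hasRank_serreTwist`,
★ `hasRank_lineBundle`) and the same determinant class (★ `nonempty_iso_iff_detClass_eq`, ★ `detClass_lineBundle`, ★ `cechClass_eq_mk`).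
[cite: Hartshorne1977, II Prop. 5.12] [cite: GortzWedhorn2020, Prop. 11.21 (p. 302)] -/
theorem nonempty_dual_serreTwist_iso_lineBundle (m : ℕ) (a₀ : Fin (r + 1))
    (ha₀ : genericPoint Z ∈ (GeneratingSections.ofHom ι).U a₀) :
    Nonempty (dual (serreTwist ι m) ≅
      Modules.lineBundle (m • (GeneratingSections.ofHom ι).divisor a₀ ha₀).toUnitCocycle) := by
  refine (nonempty_iso_iff_detClass_eq (hasRank_dual (hasRank_serreTwist ι m))
    (m • (GeneratingSections.ofHom ι).divisor a₀ ha₀).toUnitCocycle.hasRank_lineBundle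
    (isFiniteLocallyFree_dual (isFiniteLocallyFree_serreTwist ι m))
    (m • (GeneratingSections.ofHom ι).divisor a₀ ha₀).toUnitCocycle.isFiniteLocallyFree_lineBundle).2 ?_
  rw [detClass_dual_serreTwist_eq, UnitCocycle.detClass_lineBundle, CartierDivisor.cechClass_eq_mk]

end DetClass

/-! ### §4 (edition 2) Naturality of the chart cocycle: composition with a morphism, and powers -/

section Naturality

variable {A : Type u} [CommRing A] {r : ℕ} {Y Z : Scheme.{u}} (k : Y ⟶ Z) (φ : Z ⟶ PP A r)

/-- A chart choice: every point of `Z` lies in some chart `Z_j = φ⁻¹D₊(x_j)` (the `Z_j` cover `Z`, ★ `iSup_cover_eq_top`).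
[cite: Hartshorne1977, II Prop. 5.12] -/
theorem exists_mem_Zop_singleton (z : Z) : ∃ j : Fin (r + 1), z ∈ Zop φ {j} := by
  have hz : z ∈ (⊤ : Z.Opens) := trivial
  rw [← iSup_cover_eq_top φ] at hz
  exact Opens.mem_iSup.mp hz

/-- **`[𝒪_Z(-m)] = [𝒪_Z(-1)]^m` in `Ȟ¹(Z, 𝒪_Z^×)`** for ANY `φ : Z ⟶ 𝐏ʳ_A` (no integrality): the chart frame systems of
`serreTwist φ m` and `serreTwist φ 1` on the same charts `Z_{j(z)}` have transition functions `(x_j/x_{j'})^m` and `x_j/x_{j'}`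
(`transitionDet_chartFrame`), and the class of the `m`-th power cocycle is the `m`-th power of the class (`CechPic.mk_mul`,
induction on `m`). [cite: Hartshorne1977, II Prop. 5.12 (b)] [cite: Hartshorne1977, II Ex. 5.16 (d)] -/
theorem detClass_serreTwist_eq_pow (m : ℕ) :
    detClass (isFiniteLocallyFree_serreTwist φ m) = detClass (isFiniteLocallyFree_serreTwist φ 1) ^ m := by
  classical
  choose a ha using exists_mem_Zop_singleton φ
  -- the chart frame systems of `𝒪_Z(-n)`, all on the charts `Z_{a z}`
  let G : ∀ n : ℕ, FrameSystem (serreTwist φ n) := fun n =>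
    { U := fun z => Zop φ {a z}
      mem := ha
      I := fun _ => PUnit.{u + 1}
      rank := fun _ => 1
      enum := fun _ => _root_.Equiv.ofUnique PUnit (Fin 1)
      frame := fun z => freePUnitIso (Zop φ {a z}) ≪≫ (overIsoUnit φ n (a z)).symm }
  have hGg : ∀ (n : ℕ) (x y : Z) (V : Z.Opens) (hx : V ≤ Zop φ {a x}) (hy : V ≤ Zop φ {a y}),
      (G n).cocycle.g x y V hx hy = Z.presheaf.map (homOfLE hy).op (chartFun φ (a x) (a y)) ^ n :=
    fun n x y V hx hy => transitionDet_chartFrame φ n (a x) (a y) hx hy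
  rw [detClass_eq_mk _ (G m), detClass_eq_mk _ (G 1)]
  suffices h : ∀ n : ℕ, CechPic.mk (G n).cocycle = CechPic.mk (G 1).cocycle ^ n from h m
  intro n
  induction n with
  | zero =>
    rw [pow_zero, ← CechPic.mk_one]
    exact CechPic.sound (UnitCocycle.equiv_of_eq _ _ (fun z => Zop φ {a z}) ha (fun _ => le_rfl) (fun _ => le_top)
      fun x y V hx hy => by change (1 : Γ(Z, V)) = (G 0).cocycle.g x y V _ _; rw [hGg, pow_zero])
  | succ n ih =>
    rw [pow_succ, ← ih, ← CechPic.mk_mul]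
    refine CechPic.sound (UnitCocycle.equiv_of_eq _ _ (fun z => Zop φ {a z}) ha (fun _ => le_rfl)
      (fun _ => le_inf le_rfl le_rfl) fun x y V hx hy => ?_)
    change (G n).cocycle.g x y V _ _ * (G 1).cocycle.g x y V _ _ = (G (n + 1)).cocycle.g x y V _ _
    rw [hGg, hGg, hGg, pow_one, pow_succ]

/-- **`[𝒪_Z(-m·t)] = [𝒪_Z(-m)]^t`** (the form the Siegel-moduli `hF9` assembly reads: `e·e = m·t` between the degree of the covering
forms and the twist of the projective embedding). [cite: Hartshorne1977, II Prop. 5.12 (b)] -/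
theorem detClass_serreTwist_mul (m t : ℕ) :
    detClass (isFiniteLocallyFree_serreTwist φ (m * t)) = detClass (isFiniteLocallyFree_serreTwist φ m) ^ t := by
  rw [detClass_serreTwist_eq_pow φ (m * t), detClass_serreTwist_eq_pow φ m, pow_mul]

/-- **`[𝒪_Y(-m)] = k^*[𝒪_Z(-m)]`: the class of the Serre twist along `k ≫ φ` is the pull-back of the class along `φ`**
(`𝒪(n)` is compatible with base change, Hartshorne II Prop. 5.12 (c); on classes II Ex. 6.8).  The charts of `k ≫ φ` are the
preimages `k⁻¹Z_j` and its chart functions the pulled-back ones (definitionally), so the chart frame system of `serreTwist (k ≫ φ) m`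
on the charts `k⁻¹Z_{j(k y)}` has the PULLED-BACK cocycle (★ `UnitCocycle.pullback`, ★ `CechPic.pullback_mk`).
[cite: Hartshorne1977, II Prop. 5.12 (c)] [cite: Hartshorne1977, II Ex. 6.8] -/
theorem detClass_serreTwist_comp (m : ℕ) :
    detClass (isFiniteLocallyFree_serreTwist (k ≫ φ) m) =
      CechPic.pullback k (detClass (isFiniteLocallyFree_serreTwist φ m)) := by
  classical
  choose a ha using exists_mem_Zop_singleton φ
  -- the chart frame system of `𝒪_Z(-m)` on the charts `Z_{a z}`
  let G : FrameSystem (serreTwist φ m) :=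
    { U := fun z => Zop φ {a z}
      mem := ha
      I := fun _ => PUnit.{u + 1}
      rank := fun _ => 1
      enum := fun _ => _root_.Equiv.ofUnique PUnit (Fin 1)
      frame := fun z => freePUnitIso (Zop φ {a z}) ≪≫ (overIsoUnit φ m (a z)).symm }
  have hGg : ∀ (x y : Z) (V : Z.Opens) (hx : V ≤ Zop φ {a x}) (hy : V ≤ Zop φ {a y}),
      G.cocycle.g x y V hx hy = Z.presheaf.map (homOfLE hy).op (chartFun φ (a x) (a y)) ^ m :=
    fun x y V hx hy => transitionDet_chartFrame φ m (a x) (a y) hx hy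
  -- the chart frame system of `𝒪_Y(-m)` along `k ≫ φ` on the charts `(k ≫ φ)⁻¹D₊(x_{a (k y)}) = k⁻¹Z_{a (k y)}`
  let G' : FrameSystem (serreTwist (k ≫ φ) m) :=
    { U := fun y => Zop (k ≫ φ) {a (k.base y)}
      mem := fun y => show k.base y ∈ Zop φ {a (k.base y)} from ha (k.base y)
      I := fun _ => PUnit.{u + 1}
      rank := fun _ => 1
      enum := fun _ => _root_.Equiv.ofUnique PUnit (Fin 1)
      frame := fun y => freePUnitIso (Zop (k ≫ φ) {a (k.base y)}) ≪≫ (overIsoUnit (k ≫ φ) m (a (k.base y))).symm }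
  have hG'g : ∀ (x y : Y) (V : Y.Opens) (hx : V ≤ Zop (k ≫ φ) {a (k.base x)}) (hy : V ≤ Zop (k ≫ φ) {a (k.base y)}),
      G'.cocycle.g x y V hx hy = Y.presheaf.map (homOfLE hy).op (chartFun (k ≫ φ) (a (k.base x)) (a (k.base y))) ^ m :=
    fun x y V hx hy => transitionDet_chartFrame (k ≫ φ) m (a (k.base x)) (a (k.base y)) hx hy
  rw [detClass_eq_mk _ G', detClass_eq_mk _ G, CechPic.pullback_mk]
  refine CechPic.sound (UnitCocycle.equiv_of_eq _ _ (fun y => Zop (k ≫ φ) {a (k.base y)}) G'.mem (fun _ => le_rfl)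
    (fun _ => le_rfl) fun x y V hx hy => ?_)
  -- the pulled-back transition function is the transition function of the pulled-back charts
  change k.appLE (Zop φ {a (k.base x)} ⊓ Zop φ {a (k.base y)}) V _
      (G.cocycle.g (k.base x) (k.base y) _ inf_le_left inf_le_right) = G'.cocycle.g x y V _ _
  rw [hGg, hG'g, map_pow]
  congr 1
  rw [← CommRingCat.comp_apply (Z.presheaf.map (homOfLE _).op) (k.appLE _ V _), Scheme.Hom.map_appLE]
  change _ = (k.app (Zop φ {a (k.base y)}) ≫ Y.presheaf.map (homOfLE hy).op) (chartFun φ (a (k.base x)) (a (k.base y)))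
  rw [Scheme.Hom.app_eq_appLE, Scheme.Hom.appLE_map]

end Naturality

end SerreTwist

end Literature.AlgebraicGeometry.Modules

end
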